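import Literature.NumberTheory.Automorphic.HyperspecialUnitarySatakeWeylInvariance
import Literature.NumberTheory.Automorphic.UnitaryRankOneBasicHeckeOperator
import HarnessLib

/-!
# The target of the Satake isomorphism of `U(σ, J₀)`: the algebra `R[Λ⁻]^W` of Weyl-invariant Laurent polynomials on the
# antisymmetric cocharacters, and `range 𝒮 ⊆ R[Λ⁻]^W` in every rank (Cartier 1979 §IV Thm. 4.1; Satake 1963 §6)

Topic `NumberTheory/Automorphic`; namespace `Literature.NumberTheory.Automorphic.HermitianLattice[.UnramifiedLocalConjDatum]`
(lane `lit-hodgefound`, Track 2 foundations; seat `lit-hodgefound-p11`, generation 48, row g48-#6).  DEFINITIONS with bodies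
(`antisymmLattice`, `antisymmSupported`, `unitarySatakeWeylGroup`, `unitarySatakeTarget`) + theorems; no named fact, no instance,
no notation.

## The mathematics

For the quasi-split unitary group `G = U_N = U(σ, J₀^{(N)})` with hyperspecial `K₀`, the cocharacter lattice of the maximal
split torus is `Λ⁻ = {μ ∈ ℤ^N : μ ∘ rev = -μ} ≅ ℤ^{⌊N/2⌋}` and the relative Weyl group `W = (ℤ/2)^{⌊N/2⌋} ⋊ S_{⌊N/2⌋}` acts on
`ℤ^N ⊇ Λ⁻` through the coordinate permutations commuting with `rev` ([BruhatTits1972] (4.4.3)).  The TARGET of the Satake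
isomorphism ([CartierCorvallis1979] §IV Thm. 4.1: `𝒮 : ℋ(G, K₀) ⥲ ℂ[Λ⁻]^W`) is the subalgebra
`R[Λ⁻]^W = {f ∈ R[ℤ^N] : supp f ⊆ Λ⁻, f(μ ∘ π) = f(μ) ∀ π ∈ W} ⊆ R[ℤ^N]`; this file defines it (as the intersection of the
range of `R[Λ⁻] → R[ℤ^N]` with the tree's `weylInvariants R ℤ^N W`, `W = unitarySatakeWeylGroup N ≤ Aut_ℤ(ℤ^N)`) and proves
**`𝒮_w(T) ∈ R[Λ⁻]^W` for every `T ∈ ℋ_R(G, K₀)`** — over every commutative ring `R` containing `q_F` as a unit (weight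
`w = u^{-⟨ν,·⟩}`, `(u : R) = q_F`; `HyperspecialUnitarySatakeWeylInvariance` + the support theorem
`coeff_satakeTransform_eq_zero_of_not_rev`), and for the tree's `ℂ`-valued transform `hd.satakeTransform` (weight `q^{-⟨ν,·⟩/2}`,
`√q = q_F` by `residueCardSqrt_eq_natCast_sqrt`): `range 𝒮 ≤ ℂ[Λ⁻]^W`.  With `HyperspecialUnitarySatakeInjective` this is the
Satake isomorphism up to the surjectivity onto `ℂ[Λ⁻]^W` (the sequel).

## What is formalised

* §1 `antisymmLattice Λ⁻`, `antisymmSupported R N = R[Λ⁻] ⊆ R[ℤ^N]` (`mem_antisymmSupported_iff`: support in `Λ⁻`),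
  `unitarySatakeWeylGroup N ≤ Aut_ℤ(ℤ^N)` (`mem_weylInvariants_unitarySatakeWeylGroup_iff`: coefficientwise `W`-invariance),
  `unitarySatakeTarget R N = R[Λ⁻]^W` (`mem_unitarySatakeTarget_iff`).
* §2 **`isIwasawaExponent_satakeTransform_mem_unitarySatakeTarget`** (every `R`, `u = q_F ∈ Rˣ`),
  **`satakeTransform_mem_unitarySatakeTarget`** and **`range_satakeTransform_le_unitarySatakeTarget`** (the `ℂ`-valued `𝒮`).

## References
* [CartierCorvallis1979] P. Cartier, *Representations of 𝔭-adic groups: a survey*, PSPM 33.1 (1979), §IV (4.2), Thm. 4.1, §IV.2.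
* [Satake1963] I. Satake, *Theory of spherical functions on reductive algebraic groups over 𝔭-adic fields*, Publ. Math. IHÉS 18
  (1963), §6.
* [BruhatTits1972] F. Bruhat, J. Tits, *Groupes réductifs sur un corps local I*, Publ. Math. IHÉS 41 (1972), (4.4.3).
* [Minguez2011] A. Mínguez, *Unramified representations of unitary groups*, in: *On the stabilization of the trace formula* (2011), §4.
* [BorelCorvallis1979] A. Borel, *Automorphic L-functions*, PSPM 33.2 (1979), §6, §7.
-/

noncomputable section

open scoped Valued WithZero Matrix MatrixGroups
open MonoidAlgebra Representation

namespace Literature.NumberTheory.Automorphic.HermitianLattice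

open Literature.NumberTheory.Automorphic Literature.NumberTheory.Automorphic.CartanUnique

variable {K : Type*} [Field K] [Valued K ℤᵐ⁰] {σ : K →+* K} {ϖ : K} {R : Type*} [CommRing R] {N : ℕ}

/-! ## §1 `R[Λ⁻]^W` -/

section Target

variable (N) in
/-- **`Λ⁻`**: the antisymmetric cocharacters `{μ ∈ ℤ^N : μ ∘ rev = -μ}` — the cocharacter lattice of the maximal split torus of
`U(σ, J₀^{(N)})`. [cite: BruhatTits1972, (4.4.3)] -/
def antisymmLattice : AddSubgroup (Fin N → ℤ) where
  carrier := {μ | ∀ i, μ (Fin.rev i) = -μ i}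
  add_mem' {a b} ha hb i := by simp only [Set.mem_setOf_eq] at ha hb; rw [Pi.add_apply, Pi.add_apply, ha i, hb i, neg_add]
  zero_mem' i := by simp
  neg_mem' {a} ha i := by simp only [Set.mem_setOf_eq] at ha; rw [Pi.neg_apply, Pi.neg_apply, ha i]

/-- Membership in `Λ⁻`. [cite: BruhatTits1972, (4.4.3)] -/
@[simp] theorem mem_antisymmLattice_iff (μ : Fin N → ℤ) : μ ∈ antisymmLattice N ↔ ∀ i, μ (Fin.rev i) = -μ i := Iff.rfl

variable (R N) in
/-- **`R[Λ⁻] ⊆ R[ℤ^N]`**: the subalgebra of Laurent polynomials supported on the antisymmetric cocharacters (the range of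
`R[Λ⁻] → R[ℤ^N]`). [cite: CartierCorvallis1979, §IV.2] -/
def antisymmSupported : Subalgebra R (AddMonoidAlgebra R (Fin N → ℤ)) :=
  (AddMonoidAlgebra.mapDomainAlgHom R R (antisymmLattice N).subtype).range

/-- `f ∈ R[Λ⁻]` iff every coefficient of `f` off `Λ⁻` vanishes. [cite: CartierCorvallis1979, §IV.2] -/
theorem mem_antisymmSupported_iff (f : AddMonoidAlgebra R (Fin N → ℤ)) :
    f ∈ antisymmSupported R N ↔ ∀ μ : Fin N → ℤ, (¬ ∀ i, μ (Fin.rev i) = -μ i) → f.coeff μ = 0 := by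
  constructor
  · intro hf μ hμ
    obtain ⟨g, rfl⟩ := (AlgHom.mem_range _).1 hf
    rw [AddMonoidAlgebra.mapDomainAlgHom_apply, AddMonoidAlgebra.mapDomain, AddMonoidAlgebra.coeff_ofCoeff]
    exact Finsupp.mapDomain_notin_range _ _ fun ⟨ν, hν⟩ => hμ (by rw [← hν]; exact ν.2)
  · intro h
    refine (AlgHom.mem_range _).2 ⟨AddMonoidAlgebra.comapDomain (antisymmLattice N).subtype (fun _ _ hab => Subtype.ext hab) f, ?_⟩
    rw [AddMonoidAlgebra.mapDomainAlgHom_apply]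
    refine AddMonoidAlgebra.mapDomain_comapDomain (fun μ hμ => ?_) _
    have hne : f.coeff μ ≠ 0 := Finsupp.mem_support_iff.1 hμ
    by_cases hanti : ∀ i, μ (Fin.rev i) = -μ i
    · exact ⟨⟨μ, hanti⟩, rfl⟩
    · exact absurd (h μ hanti) hne

variable (N) in
/-- **The Weyl group `W` of `U(σ, J₀^{(N)})` acting on `ℤ^N`**: the subgroup of `Aut_ℤ(ℤ^N)` generated by the coordinate permutations
commuting with `rev` (`W = C_{S_N}(rev) ≅ (ℤ/2)^{⌊N/2⌋} ⋊ S_{⌊N/2⌋}`, type `C`/`BC`). [cite: BruhatTits1972, (4.4.3)]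
[cite: BorelCorvallis1979, §6] -/
def unitarySatakeWeylGroup : Subgroup ((Fin N → ℤ) ≃ₗ[ℤ] (Fin N → ℤ)) :=
  Subgroup.closure (Set.range fun π : {π : Equiv.Perm (Fin N) // ∀ i, π (Fin.rev i) = Fin.rev (π i)} =>
    LinearEquiv.funCongrLeft ℤ ℤ (π : Equiv.Perm (Fin N)))

/-- **Membership in `R[ℤ^N]^W`** is coefficientwise invariance under every `rev`-commuting coordinate permutation.
[cite: CartierCorvallis1979, §IV.2] [cite: BruhatTits1972, (4.4.3)] -/
theorem mem_weylInvariants_unitarySatakeWeylGroup_iff (f : AddMonoidAlgebra R (Fin N → ℤ)) :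
    f ∈ weylInvariants R (Fin N → ℤ) (unitarySatakeWeylGroup N) ↔
      ∀ π : Equiv.Perm (Fin N), (∀ i, π (Fin.rev i) = Fin.rev (π i)) → ∀ μ : Fin N → ℤ, f.coeff (μ ∘ π) = f.coeff μ := by
  rw [mem_weylInvariants_iff]
  constructor
  · intro h π hπ μ
    have h1 := (domCongr_eq_self_iff_coeff _ _).1 (h _ (Subgroup.subset_closure ⟨⟨π, hπ⟩, rfl⟩)) μ
    rw [SymmLaurent.funCongrLeft_toAddEquiv_apply] at h1
    exact h1
  · intro h w hw
    unfold unitarySatakeWeylGroup at hw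
    induction hw using Subgroup.closure_induction with
    | mem w hw =>
      obtain ⟨⟨π, hπ⟩, rfl⟩ := hw
      rw [domCongr_eq_self_iff_coeff]
      intro μ
      rw [SymmLaurent.funCongrLeft_toAddEquiv_apply]
      exact h π hπ μ
    | one =>
      rw [domCongr_eq_self_iff_coeff]
      intro x
      rfl
    | mul a b _ _ ha hb =>
      rw [domCongr_eq_self_iff_coeff] at ha hb ⊢
      intro x
      exact (ha (b x)).trans (hb x)
    | inv a _ ha =>
      rw [domCongr_eq_self_iff_coeff] at ha ⊢
      intro x
      have hx := ha (a.symm x)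
      change f.coeff (a (a.symm x)) = f.coeff (a.symm x) at hx
      rw [LinearEquiv.apply_symm_apply] at hx
      change f.coeff (a⁻¹ x) = f.coeff x
      rw [LinearEquiv.coe_inv]
      exact hx.symm

variable (R N) in
/-- **`R[Λ⁻]^W`**, the target of the Satake isomorphism of `U(σ, J₀^{(N)})`: Laurent polynomials supported on `Λ⁻` and invariant
under the Weyl group. [cite: CartierCorvallis1979, §IV Thm. 4.1] [cite: Satake1963, §6] -/
def unitarySatakeTarget : Subalgebra R (AddMonoidAlgebra R (Fin N → ℤ)) :=
  antisymmSupported R N ⊓ weylInvariants R (Fin N → ℤ) (unitarySatakeWeylGroup N)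

/-- Membership in `R[Λ⁻]^W`, coefficientwise. [cite: CartierCorvallis1979, §IV Thm. 4.1] -/
theorem mem_unitarySatakeTarget_iff (f : AddMonoidAlgebra R (Fin N → ℤ)) :
    f ∈ unitarySatakeTarget R N ↔
      (∀ μ : Fin N → ℤ, (¬ ∀ i, μ (Fin.rev i) = -μ i) → f.coeff μ = 0) ∧
        ∀ π : Equiv.Perm (Fin N), (∀ i, π (Fin.rev i) = Fin.rev (π i)) → ∀ μ : Fin N → ℤ, f.coeff (μ ∘ π) = f.coeff μ := by
  exact Algebra.mem_inf.trans (and_congr (mem_antisymmSupported_iff f) (mem_weylInvariants_unitarySatakeWeylGroup_iff f))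

end Target

/-! ## §2 `range 𝒮 ⊆ R[Λ⁻]^W` -/

namespace UnramifiedLocalConjDatum

/-- **`𝒮_w(T) ∈ R[Λ⁻]^W`** for every commutative ring `R`, `u ∈ Rˣ` with `(u : R) = q_F`, `w = u^{-⟨ν,·⟩}` and every
`T ∈ ℋ_R(U(σ, J₀^{(N)}), K₀)` (`σ ≠ id`, finite residue field). [cite: CartierCorvallis1979, §IV Thm. 4.1] [cite: Satake1963, §6]
[cite: Minguez2011, §4] -/
theorem isIwasawaExponent_satakeTransform_mem_unitarySatakeTarget (hd : UnramifiedLocalConjDatum σ ϖ) [Finite 𝓀[K]]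
    (hσ : ∃ x : K, σ x ≠ x) (u : Rˣ) (hu : (u : R) = Nat.sqrt (Nat.card 𝓀[K])) (w : Multiplicative (Fin N → ℤ) →* R)
    (hw : ∀ e : Fin N → ℤ, w (Multiplicative.ofAdd e) = ((u ^ (-satakeTwistExp e) : Rˣ) : R))
    (T : heckeAlgebra R (unitaryGroupOfForm σ ((StdForm.antidiagonal N).over K)) (unitaryInt σ ((StdForm.antidiagonal N).over K))) :
    (hd.isIwasawaExponent (N := N)).satakeTransform w T ∈ unitarySatakeTarget R N :=
  (mem_unitarySatakeTarget_iff _).2 ⟨fun _ hμ => hd.coeff_satakeTransform_eq_zero_of_not_rev w T hμ,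
    fun π hπ μ => hd.coeff_satakeTransform_comp_perm_of_units_unitary hσ u hu N w hw T π hπ μ⟩

/-- The weight of the `ℂ`-valued transform is `u^{-⟨ν,·⟩}` for the unit `u = √q = q_F` of `ℂ`. [cite: CartierCorvallis1979, §IV (4.2)] -/
theorem satakeWeightHom_ofAdd_eq_units_zpow [Finite 𝓀[K]] (e : Fin N → ℤ) :
    satakeWeightHom (residueCardSqrt K) residueCardSqrt_ne_zero (Multiplicative.ofAdd e) =
      (((Units.mk0 (residueCardSqrt K) residueCardSqrt_ne_zero) ^ (-satakeTwistExp e) : ℂˣ) : ℂ) := by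
  rw [satakeWeightHom_ofAdd, satakeWeight, Units.val_zpow_eq_zpow_val, Units.val_mk0]

/-- **`𝒮(T) ∈ ℂ[Λ⁻]^W`** for the tree's `ℂ`-valued Satake transform `hd.satakeTransform` (weight `q^{-⟨ν,·⟩/2}`) and every
`T ∈ ℋ(U(σ, J₀^{(N)}), K₀)`. [cite: CartierCorvallis1979, §IV Thm. 4.1] [cite: Satake1963, §6] -/
theorem satakeTransform_mem_unitarySatakeTarget (hd : UnramifiedLocalConjDatum σ ϖ) [Finite 𝓀[K]] (hσ : ∃ x : K, σ x ≠ x)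
    (T : heckeAlgebra ℂ (unitaryGroupOfForm σ ((StdForm.antidiagonal N).over K)) (unitaryInt σ ((StdForm.antidiagonal N).over K))) :
    hd.satakeTransform T ∈ unitarySatakeTarget ℂ N := by
  rw [hd.satakeTransform_eq_isIwasawaExponent_satakeTransform]
  refine hd.isIwasawaExponent_satakeTransform_mem_unitarySatakeTarget hσ (Units.mk0 (residueCardSqrt K) residueCardSqrt_ne_zero)
    ?_ _ satakeWeightHom_ofAdd_eq_units_zpow T
  rw [Units.val_mk0, hd.residueCardSqrt_eq_natCast_sqrt hσ]

/-- **`range 𝒮 ≤ ℂ[Λ⁻]^W`.** [cite: CartierCorvallis1979, §IV Thm. 4.1] [cite: Satake1963, §6] -/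
theorem range_satakeTransform_le_unitarySatakeTarget (hd : UnramifiedLocalConjDatum σ ϖ) [Finite 𝓀[K]] (hσ : ∃ x : K, σ x ≠ x) :
    (hd.satakeTransform (N := N)).range ≤ unitarySatakeTarget ℂ N := by
  rintro f ⟨T, rfl⟩
  exact hd.satakeTransform_mem_unitarySatakeTarget hσ T

end UnramifiedLocalConjDatum

end Literature.NumberTheory.Automorphic.HermitianLattice

end
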